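import Mathlib.MeasureTheory.Covering.BesicovitchVectorSpace
import Mathlib.MeasureTheory.Measure.Lebesgue.VolumeOfBalls
import Mathlib.Analysis.InnerProductSpace.PiL2
import HarnessLib

/-!
# Texture build, TB-B: disjoint disc patterns filling the unit square up to `ε` (L-pack, H1)

TB-0.md §9.5 places wall cells on the gentle pieces of a sheet as DISJOINT DISCS of several radii covering
all but a fraction `θ′` of the area (one radius cannot beat `π/(2√3)`).  The pattern is this file's
`exists_disc_pattern`: for every `ε > 0` there are finitely many pairwise disjoint closed discs inside the
open unit square of total area `≥ 1 − ε` (hence with a positive least radius); scaled copies tile any square.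
Proof: the Besicovitch–Vitali covering theorem (`Besicovitch.exists_disjoint_closedBall_covering_ae`,
Mathlib) gives a countable disjoint family of closed discs inside the square covering almost all of it;
continuity of the measure along the accumulated unions gives a finite sub-family.  [folklore; cf. Mattila,
*Geometry of Sets and Measures in Euclidean Spaces* (1995), Thm 2.8]
-/

noncomputable section

open MeasureTheory Metric Set Filter Topology
open scoped ENNReal

namespace Summit.Ventures.Crystal3D.Theorems

/-- the plane -/
abbrev E2 : Type := EuclideanSpace ℝ (Fin 2)

/-- the open unit square of the plane -/
def unitSquare : Set E2 := {p | ∀ t : Fin 2, 0 < p t ∧ p t < 1}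

/-- Coordinates are `1`-Lipschitz in the plane. -/
theorem abs_sub_apply_le_dist_two (p q : E2) (t : Fin 2) : |p t - q t| ≤ dist p q := by
  rw [EuclideanSpace.dist_eq]
  have h : (p t - q t) ^ 2 ≤ ∑ j, dist (p j) (q j) ^ 2 := by
    have := Finset.single_le_sum (f := fun j => dist (p j) (q j) ^ 2) (fun j _ => sq_nonneg _)
      (Finset.mem_univ t)
    simpa [Real.dist_eq, sq_abs] using this
  calc |p t - q t| = Real.sqrt ((p t - q t) ^ 2) := (Real.sqrt_sq_eq_abs _).symm
    _ ≤ Real.sqrt (∑ j, dist (p j) (q j) ^ 2) := Real.sqrt_le_sqrt h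

/-- The open unit square has area `1`. -/
theorem volume_unitSquare : volume unitSquare = 1 := by
  have hpre : unitSquare = (WithLp.ofLp : E2 → (Fin 2 → ℝ)) ⁻¹'
      (Set.pi Set.univ fun _ : Fin 2 => Set.Ioo (0 : ℝ) 1) := by
    ext p
    simp only [unitSquare, Set.mem_setOf_eq, Set.mem_preimage, Set.mem_pi, Set.mem_univ, true_implies,
      Set.mem_Ioo]
  rw [hpre, (PiLp.volume_preserving_ofLp (Fin 2)).measure_preimage
    (MeasurableSet.univ_pi fun _ => measurableSet_Ioo).nullMeasurableSet,
    Real.volume_pi_Ioo]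
  simp

/-- **Disc patterns.**  For every `ε > 0` there is a finite family of pairwise disjoint closed discs inside the
open unit square with total area `∑ π r² ≥ 1 − ε`. -/
theorem exists_disc_pattern (ε : ℝ) (hε : 0 < ε) :
    ∃ (T : Finset E2) (r : E2 → ℝ), (∀ x ∈ T, 0 < r x ∧ closedBall x (r x) ⊆ unitSquare) ∧
      (↑T : Set E2).PairwiseDisjoint (fun x => closedBall x (r x)) ∧
      1 - ε ≤ ∑ x ∈ T, Real.pi * r x ^ 2 := by
  classical
  -- margins
  set R : E2 → ℝ := fun x => min (min (x 0) (1 - x 0)) (min (x 1) (1 - x 1)) with hRdef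
  have hRpos : ∀ x ∈ unitSquare, 0 < R x := by
    intro x hx
    have h0 := hx 0; have h1 := hx 1
    simp only [hRdef, lt_min_iff]; refine ⟨⟨h0.1, by linarith [h0.2]⟩, h1.1, by linarith [h1.2]⟩
  have hball : ∀ x ∈ unitSquare, ∀ ρ, ρ < R x → closedBall x ρ ⊆ unitSquare := by
    intro x hx ρ hρ y hy
    rw [mem_closedBall] at hy
    intro t
    have ht := abs_sub_apply_le_dist_two y x t
    have hlt : |y t - x t| < R x := lt_of_le_of_lt (ht.trans hy) hρ
    rw [abs_lt] at hlt
    have hR0 : R x ≤ x t ∧ R x ≤ 1 - x t := by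
      fin_cases t
      · exact ⟨(min_le_left _ _).trans (min_le_left _ _), (min_le_left _ _).trans (min_le_right _ _)⟩
      · exact ⟨(min_le_right _ _).trans (min_le_left _ _), (min_le_right _ _).trans (min_le_right _ _)⟩
    constructor <;> linarith [hR0.1, hR0.2]
  -- Besicovitch–Vitali
  obtain ⟨t, r, tcount, tU, hr, hae, hdisj⟩ :=
    Besicovitch.exists_disjoint_closedBall_covering_ae (volume : Measure E2) (fun _ => Set.univ) unitSquare
      (fun x _ δ hδ => ⟨δ / 2, Set.mem_univ _, by constructor <;> linarith⟩) R hRpos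
  have hrU : ∀ x ∈ t, 0 < r x ∧ closedBall x (r x) ⊆ unitSquare := fun x hx =>
    ⟨(hr x hx).2.1, hball x (tU hx) _ (hr x hx).2.2⟩
  set V : Set E2 := ⋃ x ∈ t, closedBall x (r x) with hVdef
  have hVU : V ⊆ unitSquare := Set.iUnion₂_subset fun x hx => (hrU x hx).2
  have hV1 : volume V = 1 := by
    apply le_antisymm
    · exact (measure_mono hVU).trans_eq volume_unitSquare
    · calc (1 : ℝ≥0∞) = volume unitSquare := volume_unitSquare.symm
        _ ≤ volume V + volume (unitSquare \ V) := by
            calc volume unitSquare ≤ volume (V ∪ unitSquare \ V) := measure_mono (by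
                  rw [Set.union_sdiff_self]; exact Set.subset_union_right)
              _ ≤ volume V + volume (unitSquare \ V) := measure_union_le _ _
        _ = volume V := by rw [hae, add_zero]
  -- `t` is nonempty; enumerate it
  have htne : t.Nonempty := by
    by_contra h
    rw [Set.not_nonempty_iff_eq_empty] at h
    have : V = ∅ := by rw [hVdef, h]; simp
    rw [this, measure_empty] at hV1
    exact zero_ne_one hV1
  obtain ⟨g, hg⟩ := tcount.exists_eq_range htne
  have hgt : ∀ n, g n ∈ t := fun n => by rw [hg]; exact Set.mem_range_self n
  set F : ℕ → Set E2 := fun n => closedBall (g n) (r (g n)) with hFdef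
  have hVF : V = ⋃ n, F n := by
    rw [hVdef, hg]; ext y; simp [hFdef]
  have htend : Tendsto (fun n => volume (Set.accumulate F n)) atTop (𝓝 (volume (⋃ n, F n))) :=
    tendsto_measure_iUnion_accumulate
  rw [← hVF, hV1] at htend
  have hlt : ENNReal.ofReal (1 - ε) < 1 := by
    rw [← ENNReal.ofReal_one]; exact (ENNReal.ofReal_lt_ofReal_iff one_pos).2 (by linarith)
  obtain ⟨n, hn⟩ := (htend.eventually_const_lt hlt).exists
  -- the finite family
  set T : Finset E2 := (Finset.range (n + 1)).image g with hTdef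
  have hTt : ∀ x ∈ T, x ∈ t := by
    intro x hx
    rw [hTdef, Finset.mem_image] at hx
    obtain ⟨k, -, rfl⟩ := hx
    exact hgt k
  have hacc : Set.accumulate F n = ⋃ x ∈ T, closedBall x (r x) := by
    ext y
    rw [Set.mem_accumulate]
    simp only [Set.mem_iUnion, hTdef, Finset.mem_image, Finset.mem_range, exists_prop, hFdef]
    constructor
    · rintro ⟨k, hk, hy⟩
      exact ⟨g k, ⟨k, by omega, rfl⟩, hy⟩
    · rintro ⟨x, ⟨k, hk, rfl⟩, hy⟩
      exact ⟨k, by omega, hy⟩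
  have hdisjT : (↑T : Set E2).PairwiseDisjoint (fun x => closedBall x (r x)) :=
    hdisj.subset fun x hx => hTt x (Finset.mem_coe.1 hx)
  refine ⟨T, r, fun x hx => hrU x (hTt x hx), hdisjT, ?_⟩
  -- areas
  have hsum : volume (⋃ x ∈ T, closedBall x (r x)) = ∑ x ∈ T, volume (closedBall x (r x)) :=
    measure_biUnion_finset hdisjT fun x _ => measurableSet_closedBall
  have hfin : ∑ x ∈ T, volume (closedBall x (r x)) =
      ENNReal.ofReal (∑ x ∈ T, Real.pi * r x ^ 2) := by
    rw [ENNReal.ofReal_sum_of_nonneg (fun x _ => by positivity)]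
    refine Finset.sum_congr rfl fun x hx => ?_
    rw [EuclideanSpace.volume_closedBall_fin_two, ← ENNReal.ofReal_pow (hrU x (hTt x hx)).1.le,
      ← ENNReal.ofReal_mul (by positivity)]
    congr 1; ring
  rw [hacc, hsum, hfin] at hn
  exact (ENNReal.ofReal_lt_ofReal_iff'.1 hn).1.le

end Summit.Ventures.Crystal3D.Theorems
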